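import Summits.QuantumFields.BalabanUV.Beta.GAN24.MultiplierDictionary
import Summits.QuantumFields.BalabanUV.Beta.HessKerDressedUnits
import Literature.MathematicalPhysics.QuantumFieldTheory.Balaban1983to89.Beta.SecondOrderResponse
import Literature.MathematicalPhysics.QuantumFieldTheory.Balaban1983to89.Beta.ResolventComposition

/-!
# `BalabanUV.Beta.GAN24.MultiplierZeroMass` — binder row G-an2-4 / (CONV-C), W-slot, road «W3» (SKELETON-W3 v0.2 §7.2, the level-`m`
# fact **(S2c)**): THE MULTIPLIER–MULTIPLIER BLOCK OF an2's PACKED RESOLVENT HAS ZERO TOTAL ROW AND COLUMN SUMS — on `ℤ^{d+1}`, every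
# blocking `N ≥ 1`, every dimension; hence the `mm` legs of the step kernel `KInvStep Lc j` and the multiplier-column weights `colM` of
# an2's second-order carrier carry ZERO MASS (idle leaf seat `b2b-balaban-gan24-formalise-leaf-14`, gen 22, invitation «W3-ZB*» of the
# row owner's RULINGS-12 (R12-7) / RULINGS-13; name provisional — the row owner gan24-p1 may rename or re-home it)

NOT IN PRINT; OUR BOOKKEEPING.  HONEST FRAMING (cell contract, verbatim): «discharging `BetaPertH` makes Bałaban's UV stability
UNCONDITIONAL — a real constructive-QFT result; it is NOT the continuum limit and NOT the Clay problem.»  HONEST DEPENDENCY (verbatim):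
«continuum YM on T⁴ ⇐ BetaPertH ∧ nine spine estimates (0/9 proved); BetaPertH ⇐ (D1) ∧ (D4) ∧ CAP+tail; G-an2-4 gates asym, D1 and
NE2/3/4.»  [folklore] kernel bookkeeping over TREE theorems BY NAME — leaf-18's torus junction `GAN24/TorusJunction.tsum_wΦ_pshift_eq_DelK`
(the `M`-periodisation of an2's `KernelSpecInstance.wΦ` IS `2·N^{−(d+5)}·Δ_k` of an5's `BlockEffectiveAction.DelK`), an5's
**`BlockEffectiveAction.DelK_mulVec_const : Δ_k(const) = 0`**, an2's `KernelSpecInstance.absMoment₂_wΦ`, an4's `OneStepKernelFamily.KInvStep`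
sockets (`KInvStep_inr_off`, `proj_pow_smul_eq_zero_iff`), an2's `ResolventComposition.zsmul_pow_succ`, `BalabanStepJetsSucc.mmRead_eq_dec`;
no estimate, no cited fact, no `def`, no `def … : Prop`, no wall binder; 0 sorry.  Discharges NOTHING of «T2Shape» / «T2SupRate» / (hW, hWall);
NOT «W-slot closed», NEVER «G-an2-4 closed»; NOT BetaPertH, NOT continuum, NOT Clay.

WHY (the located use).  The row owner's zero-mode calculus (SKELETON-W3 v0.2 §7.2) kills every channel of an2's second-order source `b_m`
on constant fields from THREE level-`m` facts: (Q-lin) — TREE (`HessianTelescopingKKT.constReproSum_stepCol`); **(S2c) «the normalised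
mm-block annihilates constants»** — recorded there as «✓ tree at d = 3 (`MultiplierDictionary.wΦ_eq_deltaZ` row sums)», but no declaration in
the tree STATES the vanishing row sums (the only `Σ wΦ … = 0` theorems are the GRADIENT forms `ValueHessianGauge.tsum_wΦ_mul_grad_eq_zero` /
`tsum_grad_mul_wΦ_eq_zero`); (S3c) — a new leaf.  THIS FILE makes (S2c) a tree theorem in the three currencies the W-slot uses:
* §1 **`tsum_wΦ_eq_zero`**: `∑' y, wΦ (N := N) κ l y = 0` — «a constant prescribed average is reproduced by a constant fine field, which costs no
  energy and carries no constraint multiplier».  Proof: the ONE-POINT torus `M := fun _ ↦ 1` of the junction (`pshift (fun _ ↦ 1) t = t`)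
  reads `∑' t, wΦ κ l t = 2·N^{−(d+5)}·Re Δ_k((·, κ), (0, l))`, and on ANY torus `Σ_{y} Δ_k(s, (y, l)) = (Δ_k · 𝟙_l)(s) = 0` by `DelK_mulVec_const`
  with the direction indicator `𝟙_l` — on the one-point torus that sum is the single entry.  Also `hasSum_wΦ_zero`, and the translated forms
  `tsum_wΦ_sub_left/right`, `hasSum_wΦ_sub_left/right` (`y ↦ w − y`, `y ↦ y − w`).
* §2 THE K-SLOT OBJECT `KInvStep Lc j` (an4): `KInvStep_inr_inr` (the `mm` legs of `dec` carry weight one), `KInvStep_inr_inr_coarse`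
  (`= wΦ^{(Lc^{j+1})} κ l (x′ − z′)` at coarse points), `KInvStep_inr_inr_off_right`; the ZERO MASSES **`hasSum_KInvStep_mm_right`**
  (`∀ z, HasSum (fun z′ ↦ KInvStep Lc j z (Lc•z′) (inr κ) (inr l)) 0`) and **`hasSum_KInvStep_mm_left`** (`∀ x, HasSum (fun x′ ↦ KInvStep Lc j (Lc•x′) x
  (inr κ) (inr l)) 0`) — EVERY fine base point (off the coarse lattice the entries vanish) — and the same for the dressed kernel
  `unitK s_f s_m (KInvStep Lc j)` of the wall's units (`hasSum_unitK_KInvStep_mm_right/left`, any reals `s_f s_m`): exactly the `mm` LEG MASSES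
  `ρR (inr κ) β = 0`, `ρL α (inr ρ) = 0` of the zero-mode Fubini lemma (leaf-02-g15's «T2-ZERO-MODE-KERNEL*»), so that lemma need not assume an
  ff-valued table.
* §3 THE (S2c) CONSEQUENCES IN an2's CARRIER VOCABULARY: the multiplier-column weights `SecondOrderResponse.colM K N μ y ρ w = K (N•w) (N•y) (inr ρ)
  (inr μ)` of `vertexOfM` / `mixOfK` / the multiplier half of `dM` have ZERO MASS in either index for `K := KInvStep Lc j` and for its dressed
  version (`hasSum_colM_KInvStep_bond/pos`, `hasSum_colM_unitK_KInvStep_bond/pos`) — the literal input by which «`mixOfK` dies on (S2c)» (§7.2).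
The zero-mode functional and its Fubini are NOT here (leaf-02-g15); nothing of an1's tables (`vh₂S`, `mixFF`, `hessFF`) is read or touched.
-/

noncomputable section

open Finset
open scoped BigOperators

namespace Summit.QuantumFields.BalabanUV.Beta.GAN24.MultiplierZeroMass

open Literature.MathematicalPhysics.QuantumFieldTheory
open Literature.MathematicalPhysics.QuantumFieldTheory.Balaban1983to89
open Literature.MathematicalPhysics.QuantumFieldTheory.Balaban1983to89.Beta
open Literature.Probability.LatticeModels (Torus.proj)
open AffineAveraging (Site)
open B5Prop11Plancherel (Tor)
open BlockEffectiveAction (DelK DelK_mulVec_const)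
open KernelSpecInstance (wΦ absMoment₂_wΦ)
open DecimatedMomentSummable (summable_of_absMoment₂)
open ExpKernelCalculus (MKer)
open LatticeForm (quo)
open OneStepResolventKernel (Fib KInv KInv_inr_inr_coarse eq_zsmul_quo_of_proj)
open OneStepKernelFamily (KInvStep dec KInvStep_inr_off proj_pow_smul_eq_zero_iff)
open BalabanStepJetsSucc (mmRead mmRead_inl_inl mmRead_eq_dec)
open ResolventComposition (zsmul_pow_succ)
open SecondOrderResponse (colM)
open Summit.QuantumFields.BalabanUV.Beta.HessKerDressedUnits (unitK unitK_apply legScale_inr)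
open Summit.QuantumFields.BalabanUV.Beta.GAN24.TorusAvatar (toTor)
open Summit.QuantumFields.BalabanUV.Beta.GAN24.TorusPeriodise (pshift)
open Summit.QuantumFields.BalabanUV.Beta.GAN24.TorusJunction (tsum_wΦ_pshift_eq_DelK)
open Summit.QuantumFields.BalabanUV.Beta.GAN24.MultiplierDictionary (pshift_const)

variable {d : ℕ}

/-! ## §1 The multiplier-response kernel `wΦ` has zero total row sums -/

section RowSum

/-- [folklore] On ANY torus, the row sums of `Δ_k` over the POSITIONS at a fixed direction vanish:
`Σ_{y} Δ_k(s, (y, l)) = (Δ_k · 𝟙_l)(s) = 0` (`BlockEffectiveAction.DelK_mulVec_const` with the direction indicator). -/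
theorem sum_DelK_dir_eq_zero (N : ℕ) [NeZero N] (hN : 1 ≤ N) (M : Fin (d + 1) → ℕ) [∀ ν, NeZero (M ν)] (a : ℝ) (ha : 0 < a)
    (s : Tor M × Fin (d + 1)) (l : Fin (d + 1)) : ∑ y : Tor M, DelK N hN M a ha s (y, l) = 0 := by
  have h := congrFun (DelK_mulVec_const N hN M a ha (fun l' : Fin (d + 1) => if l' = l then (1 : ℂ) else 0)) s
  rw [Pi.zero_apply, Matrix.mulVec, dotProduct, Fintype.sum_prod_type] at h
  simpa only [mul_ite, mul_one, mul_zero, Finset.sum_ite_eq', Finset.mem_univ, if_true] using h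

/-- [folklore] On the ONE-POINT torus every entry of `Δ_k` vanishes (the row sum of `sum_DelK_dir_eq_zero` is a single entry). -/
theorem DelK_onePoint_eq_zero (N : ℕ) [NeZero N] (hN : 1 ≤ N) (a : ℝ) (ha : 0 < a)
    (s s' : Tor (fun _ : Fin (d + 1) => (1 : ℕ)) × Fin (d + 1)) : DelK N hN (fun _ : Fin (d + 1) => (1 : ℕ)) a ha s s' = 0 := by
  haveI : Subsingleton (Tor (fun _ : Fin (d + 1) => (1 : ℕ))) := by
    refine ⟨fun x y => funext fun ν => ?_⟩
    exact Subsingleton.elim (α := ZMod 1) _ _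
  have h := sum_DelK_dir_eq_zero N hN (fun _ : Fin (d + 1) => (1 : ℕ)) a ha s s'.2
  rw [Fintype.sum_subsingleton _ s'.1] at h
  exact h

variable {N : ℕ} [NeZero N]

/-- [folklore] **(S2c) THE TOTAL ROW SUMS OF THE MULTIPLIER-RESPONSE KERNEL VANISH**: `∑' y, wΦ κ l y = 0` for every blocking `N ≥ 1`,
every dimension, all legs — a constant prescribed average is reproduced by a constant fine field, which costs no energy and carries no
constraint multiplier.  (leaf-18's junction on the one-point torus + `DelK_onePoint_eq_zero`.) -/
theorem tsum_wΦ_eq_zero (κ l : Fin (d + 1)) : ∑' y : Site (d + 1), wΦ (N := N) κ l y = 0 := by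
  have hN : 1 ≤ N := Nat.one_le_iff_ne_zero.2 (NeZero.ne N)
  have h := tsum_wΦ_pshift_eq_DelK N hN (fun _ : Fin (d + 1) => (1 : ℕ)) 1 one_pos κ l 0
  have e : (fun t : Site (d + 1) => wΦ (N := N) κ l (0 + pshift (fun _ : Fin (d + 1) => (1 : ℕ)) t)) =
      fun t => wΦ (N := N) κ l t := by
    funext t
    rw [pshift_const, one_smul, zero_add]
  rw [e] at h
  rw [h, DelK_onePoint_eq_zero, Complex.zero_re, mul_zero]

/-- [folklore] `wΦ κ l` is summable (exponential decay, `KernelSpecInstance.absMoment₂_wΦ`). -/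
theorem summable_wΦ (κ l : Fin (d + 1)) : Summable (fun y : Site (d + 1) => wΦ (N := N) κ l y) :=
  summable_of_absMoment₂ (absMoment₂_wΦ (N := N) κ l)

/-- [folklore] (S2c) as a `HasSum`. -/
theorem hasSum_wΦ_zero (κ l : Fin (d + 1)) : HasSum (fun y : Site (d + 1) => wΦ (N := N) κ l y) 0 := by
  rw [← tsum_wΦ_eq_zero (N := N) κ l]
  exact (summable_wΦ κ l).hasSum

/-- [folklore] (S2c), reflected argument `y ↦ w − y`. -/
theorem tsum_wΦ_sub_left (κ l : Fin (d + 1)) (w : Site (d + 1)) : ∑' y : Site (d + 1), wΦ (N := N) κ l (w - y) = 0 := by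
  have h := Equiv.tsum_eq (Equiv.subLeft w) (fun y => wΦ (N := N) κ l y)
  simp only [Equiv.subLeft_apply] at h
  rw [h]
  exact tsum_wΦ_eq_zero κ l

/-- [folklore] (S2c), translated argument `y ↦ y − w`. -/
theorem tsum_wΦ_sub_right (κ l : Fin (d + 1)) (w : Site (d + 1)) : ∑' y : Site (d + 1), wΦ (N := N) κ l (y - w) = 0 := by
  have h := Equiv.tsum_eq (Equiv.subRight w) (fun y => wΦ (N := N) κ l y)
  simp only [Equiv.subRight_apply] at h
  rw [h]
  exact tsum_wΦ_eq_zero κ l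

/-- [folklore] (S2c), reflected argument, as a `HasSum`. -/
theorem hasSum_wΦ_sub_left (κ l : Fin (d + 1)) (w : Site (d + 1)) : HasSum (fun y : Site (d + 1) => wΦ (N := N) κ l (w - y)) 0 := by
  rw [← tsum_wΦ_sub_left (N := N) κ l w]
  exact ((Equiv.subLeft w).summable_iff.2 (summable_wΦ (N := N) κ l)).hasSum

/-- [folklore] (S2c), translated argument, as a `HasSum`. -/
theorem hasSum_wΦ_sub_right (κ l : Fin (d + 1)) (w : Site (d + 1)) : HasSum (fun y : Site (d + 1) => wΦ (N := N) κ l (y - w)) 0 := by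
  rw [← tsum_wΦ_sub_right (N := N) κ l w]
  exact ((Equiv.subRight w).summable_iff.2 (summable_wΦ (N := N) κ l)).hasSum

end RowSum

/-! ## §2 The `mm` legs of an4's step kernel `KInvStep Lc j` have zero mass -/

section Step

variable {Lc : ℕ} [NeZero Lc]

/-- [folklore] The `mm` legs of the decimated composite resolvent carry weight one: `KInvStep Lc j x z (inr κ) (inr l) =
KInv (Lc^{j+1}) (Lc^j•x) (Lc^j•z) (inr κ) (inr l)` (`BalabanStepJetsSucc.mmRead_eq_dec`). -/
theorem KInvStep_inr_inr (j : ℕ) (x z : Site (d + 1)) (κ l : Fin (d + 1)) :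
    KInvStep (d := d) Lc j x z (Sum.inr κ) (Sum.inr l)
      = KInv (N := Lc ^ (j + 1)) (d := d) (((Lc ^ j : ℕ) : ℤ) • x) (((Lc ^ j : ℕ) : ℤ) • z) (Sum.inr κ) (Sum.inr l) := by
  unfold KInvStep
  rw [← mmRead_eq_dec, mmRead_inl_inl]

/-- [folklore] At coarse points the `mm` block of `KInvStep Lc j` is the multiplier response of the `(j+1)`-fold composite system:
`KInvStep Lc j (Lc•x′) (Lc•z′) (inr κ) (inr l) = wΦ^{(Lc^{j+1})} κ l (x′ − z′)`. -/
theorem KInvStep_inr_inr_coarse (j : ℕ) (x' z' : Site (d + 1)) (κ l : Fin (d + 1)) :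
    KInvStep (d := d) Lc j (((Lc : ℕ) : ℤ) • x') (((Lc : ℕ) : ℤ) • z') (Sum.inr κ) (Sum.inr l)
      = wΦ (N := Lc ^ (j + 1)) κ l (x' - z') := by
  rw [KInvStep_inr_inr, zsmul_pow_succ, zsmul_pow_succ, KInv_inr_inr_coarse]

/-- [folklore] Off the coarse lattice in the SECOND argument the `mm` entries vanish. -/
theorem KInvStep_inr_inr_off_right (j : ℕ) {z : Site (d + 1)} (hz : Torus.proj Lc z ≠ 0) (x : Site (d + 1)) (κ l : Fin (d + 1)) :
    KInvStep (d := d) Lc j x z (Sum.inr κ) (Sum.inr l) = 0 := by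
  rw [KInvStep_inr_inr]
  have hz' : Torus.proj (Lc ^ (j + 1)) (((Lc ^ j : ℕ) : ℤ) • z) ≠ 0 := by
    rwa [Ne, proj_pow_smul_eq_zero_iff]
  simp only [KInv, hz', and_false, if_false]

/-- [folklore] **ZERO RIGHT MASS OF THE `mm` LEGS**: for every fine base point `z`, `Σ_{z′} KInvStep Lc j z (Lc•z′) (inr κ) (inr l) = 0`
(coarse `z = Lc•w`: the row sum `Σ_{z′} wΦ κ l (w − z′) = 0` of §1; off the coarse lattice every entry is `0`). -/
theorem hasSum_KInvStep_mm_right (j : ℕ) (κ l : Fin (d + 1)) (z : Site (d + 1)) :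
    HasSum (fun z' : Site (d + 1) => KInvStep (d := d) Lc j z (((Lc : ℕ) : ℤ) • z') (Sum.inr κ) (Sum.inr l)) 0 := by
  by_cases hz : Torus.proj Lc z = 0
  · have e : (fun z' : Site (d + 1) => KInvStep (d := d) Lc j z (((Lc : ℕ) : ℤ) • z') (Sum.inr κ) (Sum.inr l))
        = fun z' => wΦ (N := Lc ^ (j + 1)) κ l (quo Lc z - z') := by
      funext z'
      conv_lhs => rw [eq_zsmul_quo_of_proj hz]
      exact KInvStep_inr_inr_coarse j (quo Lc z) z' κ l
    rw [e]
    exact hasSum_wΦ_sub_left κ l (quo Lc z)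
  · have e : (fun z' : Site (d + 1) => KInvStep (d := d) Lc j z (((Lc : ℕ) : ℤ) • z') (Sum.inr κ) (Sum.inr l)) = fun _ => 0 := by
      funext z'
      exact KInvStep_inr_off j hz κ _ _
    rw [e]
    exact hasSum_zero

/-- [folklore] **ZERO LEFT MASS OF THE `mm` LEGS**: for every fine base point `x`, `Σ_{x′} KInvStep Lc j (Lc•x′) x (inr κ) (inr l) = 0`. -/
theorem hasSum_KInvStep_mm_left (j : ℕ) (κ l : Fin (d + 1)) (x : Site (d + 1)) :
    HasSum (fun x' : Site (d + 1) => KInvStep (d := d) Lc j (((Lc : ℕ) : ℤ) • x') x (Sum.inr κ) (Sum.inr l)) 0 := by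
  by_cases hx : Torus.proj Lc x = 0
  · have e : (fun x' : Site (d + 1) => KInvStep (d := d) Lc j (((Lc : ℕ) : ℤ) • x') x (Sum.inr κ) (Sum.inr l))
        = fun x' => wΦ (N := Lc ^ (j + 1)) κ l (x' - quo Lc x) := by
      funext x'
      conv_lhs => rw [eq_zsmul_quo_of_proj hx]
      exact KInvStep_inr_inr_coarse j x' (quo Lc x) κ l
    rw [e]
    exact hasSum_wΦ_sub_right κ l (quo Lc x)
  · have e : (fun x' : Site (d + 1) => KInvStep (d := d) Lc j (((Lc : ℕ) : ℤ) • x') x (Sum.inr κ) (Sum.inr l)) = fun _ => 0 := by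
      funext x'
      exact KInvStep_inr_inr_off_right j hx _ κ l
    rw [e]
    exact hasSum_zero

/-- [folklore] `tsum` form of the right mass. -/
theorem tsum_KInvStep_mm_right (j : ℕ) (κ l : Fin (d + 1)) (z : Site (d + 1)) :
    ∑' z' : Site (d + 1), KInvStep (d := d) Lc j z (((Lc : ℕ) : ℤ) • z') (Sum.inr κ) (Sum.inr l) = 0 :=
  (hasSum_KInvStep_mm_right j κ l z).tsum_eq

/-- [folklore] `tsum` form of the left mass. -/
theorem tsum_KInvStep_mm_left (j : ℕ) (κ l : Fin (d + 1)) (x : Site (d + 1)) :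
    ∑' x' : Site (d + 1), KInvStep (d := d) Lc j (((Lc : ℕ) : ℤ) • x') x (Sum.inr κ) (Sum.inr l) = 0 :=
  (hasSum_KInvStep_mm_left j κ l x).tsum_eq

/-- [folklore] THE DRESSED KERNEL of the wall's units: the `mm` block of `unitK s_f s_m K = D K D` is `s_m²` times that of `K`, so its right
mass vanishes too (any real units `s_f`, `s_m`; for the wall `s_f = sfStep Lc j`, `s_m = smStep d Lc j`). -/
theorem hasSum_unitK_KInvStep_mm_right (sf sm : ℝ) (j : ℕ) (κ l : Fin (d + 1)) (z : Site (d + 1)) :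
    HasSum (fun z' : Site (d + 1) => unitK sf sm (KInvStep (d := d) Lc j) z (((Lc : ℕ) : ℤ) • z') (Sum.inr κ) (Sum.inr l)) 0 := by
  have h := ((hasSum_KInvStep_mm_right (Lc := Lc) j κ l z).mul_left sm).mul_right sm
  rw [mul_zero, zero_mul] at h
  refine h.congr_fun fun z' => ?_
  rw [unitK_apply, legScale_inr, legScale_inr]

/-- [folklore] … and its left mass. -/
theorem hasSum_unitK_KInvStep_mm_left (sf sm : ℝ) (j : ℕ) (κ l : Fin (d + 1)) (x : Site (d + 1)) :
    HasSum (fun x' : Site (d + 1) => unitK sf sm (KInvStep (d := d) Lc j) (((Lc : ℕ) : ℤ) • x') x (Sum.inr κ) (Sum.inr l)) 0 := by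
  have h := ((hasSum_KInvStep_mm_left (Lc := Lc) j κ l x).mul_left sm).mul_right sm
  rw [mul_zero, zero_mul] at h
  refine h.congr_fun fun x' => ?_
  rw [unitK_apply, legScale_inr, legScale_inr]

end Step

/-! ## §3 The multiplier-column weights `colM` of an2's carrier have zero mass (how `vertexOfM` / `mixOfK` die on constants) -/

section ColM

variable {Lc : ℕ} [NeZero Lc]

/-- [folklore] `colM (KInvStep Lc j) Lc μ y ρ w = wΦ^{(Lc^{j+1})} ρ μ (w − y)` (`SecondOrderResponse.colM` literal + `KInvStep_inr_inr_coarse`). -/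
theorem colM_KInvStep (j : ℕ) (μ : Fin (d + 1)) (y : Site (d + 1)) (ρ : Fin (d + 1)) (w : Site (d + 1)) :
    colM (KInvStep (d := d) Lc j) Lc μ y ρ w = wΦ (N := Lc ^ (j + 1)) ρ μ (w - y) :=
  KInvStep_inr_inr_coarse j w y ρ μ

/-- [folklore] **(S2c) FOR THE MULTIPLIER COLUMN, summed over the BOND position** `y` at a fixed multiplier slot `(ρ, w)`:
`Σ_y colM (KInvStep Lc j) Lc μ y ρ w = 0`. -/
theorem hasSum_colM_KInvStep_bond (j : ℕ) (μ ρ : Fin (d + 1)) (w : Site (d + 1)) :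
    HasSum (fun y : Site (d + 1) => colM (KInvStep (d := d) Lc j) Lc μ y ρ w) 0 := by
  simp only [colM_KInvStep]
  exact hasSum_wΦ_sub_left ρ μ w

/-- [folklore] **(S2c) FOR THE MULTIPLIER COLUMN, summed over the MULTIPLIER position** `w` at a fixed bond `(μ, y)`:
`Σ_w colM (KInvStep Lc j) Lc μ y ρ w = 0` — a constant multiplier table contracted with the multiplier rows of the `(μ, y)`-column
gives `0`: the weights of `SecondOrderResponse.vertexOfM` / `mixOfK` / the multiplier half of `dM` have zero total mass. -/
theorem hasSum_colM_KInvStep_pos (j : ℕ) (μ : Fin (d + 1)) (y : Site (d + 1)) (ρ : Fin (d + 1)) :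
    HasSum (fun w : Site (d + 1) => colM (KInvStep (d := d) Lc j) Lc μ y ρ w) 0 := by
  simp only [colM_KInvStep]
  exact hasSum_wΦ_sub_right ρ μ y

/-- [folklore] `tsum` forms. -/
theorem tsum_colM_KInvStep_bond (j : ℕ) (μ ρ : Fin (d + 1)) (w : Site (d + 1)) :
    ∑' y : Site (d + 1), colM (KInvStep (d := d) Lc j) Lc μ y ρ w = 0 :=
  (hasSum_colM_KInvStep_bond j μ ρ w).tsum_eq

/-- [folklore] `tsum` forms. -/
theorem tsum_colM_KInvStep_pos (j : ℕ) (μ : Fin (d + 1)) (y : Site (d + 1)) (ρ : Fin (d + 1)) :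
    ∑' w : Site (d + 1), colM (KInvStep (d := d) Lc j) Lc μ y ρ w = 0 :=
  (hasSum_colM_KInvStep_pos j μ y ρ).tsum_eq

/-- [folklore] The dressed kernel's multiplier column is `s_m²` times the undressed one. -/
theorem colM_unitK (sf sm : ℝ) (K : MKer (d + 1) (Fib d)) (N : ℕ) (μ : Fin (d + 1)) (y : Site (d + 1)) (ρ : Fin (d + 1))
    (w : Site (d + 1)) : colM (unitK sf sm K) N μ y ρ w = sm * colM K N μ y ρ w * sm := by
  simp only [colM, unitK_apply, legScale_inr]

/-- [folklore] (S2c) for the DRESSED step kernel `unitK s_f s_m (KInvStep Lc j)` (the wall's `K♮_j` at `s_f = sfStep Lc j`, `s_m = smStep d Lc j`),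
bond index. -/
theorem hasSum_colM_unitK_KInvStep_bond (sf sm : ℝ) (j : ℕ) (μ ρ : Fin (d + 1)) (w : Site (d + 1)) :
    HasSum (fun y : Site (d + 1) => colM (unitK sf sm (KInvStep (d := d) Lc j)) Lc μ y ρ w) 0 := by
  have h := ((hasSum_colM_KInvStep_bond (Lc := Lc) j μ ρ w).mul_left sm).mul_right sm
  rw [mul_zero, zero_mul] at h
  refine h.congr_fun fun y => ?_
  rw [colM_unitK]

/-- [folklore] (S2c) for the dressed step kernel, multiplier index. -/
theorem hasSum_colM_unitK_KInvStep_pos (sf sm : ℝ) (j : ℕ) (μ : Fin (d + 1)) (y : Site (d + 1)) (ρ : Fin (d + 1)) :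
    HasSum (fun w : Site (d + 1) => colM (unitK sf sm (KInvStep (d := d) Lc j)) Lc μ y ρ w) 0 := by
  have h := ((hasSum_colM_KInvStep_pos (Lc := Lc) j μ y ρ).mul_left sm).mul_right sm
  rw [mul_zero, zero_mul] at h
  refine h.congr_fun fun w => ?_
  rw [colM_unitK]

end ColM

end Summit.QuantumFields.BalabanUV.Beta.GAN24.MultiplierZeroMass

end
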